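import Literature.NumberTheory.Transcendental.DiazSmallness
import Literature.NumberTheory.Transcendental.DiazThm2Params
import HarnessLib

/-!
# Diaz 1989, Théorème 2 — the estimates for the chosen parameters (sizes and smallness)

Topic `Literature/NumberTheory/Transcendental` (trunk T-TRANSCEND). Second step of the reduction of
the named fact `Literature.NumberTheory.Transcendental.Diaz1989_thm2` (`DiazMain.lean`; G. Diaz,
J. Number Theory 31 (1989), Théorème 2, p. 2) to Philippon's criterion and the zero lemma: the
analogue, for the construction with `D = 1` (no power of `z`) and the parameters of
`DiazThm2Params.lean` (`L = [a₁Xᵐ]`, `M = [Xⁿ]`, `M₁ = a₂M`, `ρ = 16(n+1)X^{mn} log X`), of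
`DiazSmallness.lean` (which does this for Théorème 1, §II-4-2 of the source). With
`Φ = X^{m+n}` and `Ψ = X^{mn} log X` we bound, for all large `X`, every size entering the criterion
by a multiple of `Φ` (`eventually_deg_len`: `deg Q_{μj}, log L(Q_{μj}) ≤ c_δ Φ`) and prove the
smallness `|Q_{μj}(θ)| ≤ exp(-c_S Ψ)`, `c_S = (mn-m-n)/2^{m+2}` (`eventually_small`), from the
closed-form estimate `DiazThm1.norm_aeval_Qj_le` of `DiazEstimates.lean` (generic in `D`), the
extrapolation being made to the radius `R = 8rX^{mn-m-n}` — the hypothesis `mn > m + n` of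
Théorème 2 is what leaves room for this extrapolation. Everything here is proved.

## References

* G. Diaz, *Grands degrés de transcendance pour des familles d'exponentielles*, J. Number Theory
  31 (1989), 1–23, Théorème 2, p. 2; the scheme is that of §II-3-2 (4)–(7), §II-3-3 (8), (9),
  pp. 8–11, and §II-4-2, p. 15 (printed for Théorème 1).
* M. Waldschmidt, Ch. 14 of LNM 1752 (2001), §3 (Schneider's method on `𝔾ₘ^d`).
-/

noncomputable section

open Filter Real Finset Literature.NumberTheory.Transcendental.Asymp
  Literature.NumberTheory.Transcendental.Chudnovsky

namespace Literature.NumberTheory.Transcendental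

namespace DiazThm2

open DiazThm1 (a1 a2 one_le_a1 one_le_a2 Var theta Unk DL ExpIdx Q Qj Pj IsMinIdx T0 T1 Pmax
  Pmax_nonneg eps1 Bgr TAb LamLB rad Usum Vsum Separated card_Unk norm_aeval_Qj_le
  totalDegree_Qj_le l1_Qj_le scale_zero_eq_exp le_exp_self separated_of_measureB
  norm_last_pos_of_measureB KR)

variable {m n : ℕ}

/-- `Φ = X^{m+n}`, the order of the degrees and logarithmic heights.
[cite: Diaz1989, Théorème 2 p. 2 (our parameters; cf. §II-4-2 p. 15)] -/
def Phq (m n : ℕ) (X : ℝ) : ℝ := scale (m + n) 0 X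

/-- `Ψ = X^{mn} log X`, the order of `ρ` and of the smallness exponent.
[cite: Diaz1989, Théorème 2 p. 2 (our parameters; cf. §II-4-2 p. 15)] -/
def Psq (m n : ℕ) (X : ℝ) : ℝ := scale (m * n) 1 X

/-- `Φ ≥ 0` for `X ≥ 1`. [folklore] -/
theorem Phq_nonneg {X : ℝ} (hX : 1 ≤ X) : 0 ≤ Phq m n X := scale_nonneg hX

/-- `Ψ ≥ 0` for `X ≥ 1`. [folklore] -/
theorem Psq_nonneg {X : ℝ} (hX : 1 ≤ X) : 0 ≤ Psq m n X := scale_nonneg hX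

/-- `X ≤ Φ` for `X ≥ 1`, `m + n ≥ 1`. [folklore] -/
theorem X_le_Phq (hmn : 1 ≤ m + n) {X : ℝ} (hX : 1 ≤ X) : X ≤ Phq m n X := by
  unfold Phq scale
  rw [Real.rpow_zero, mul_one]
  have h : (1 : ℝ) ≤ ((m + n : ℕ) : ℝ) := by exact_mod_cast hmn
  calc X = X ^ (1 : ℝ) := (Real.rpow_one X).symm
    _ ≤ X ^ ((m : ℝ) + n) := Real.rpow_le_rpow_of_exponent_le hX (by push_cast at h; exact h)

/-- `log X ≤ Φ` for `X ≥ 1`, `m + n ≥ 1`. [folklore] -/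
theorem log_le_Phq (hmn : 1 ≤ m + n) {X : ℝ} (hX : 1 ≤ X) : Real.log X ≤ Phq m n X := by
  have h1 : Real.log X ≤ X := (Real.log_le_sub_one_of_pos (by linarith)).trans (by linarith)
  exact h1.trans (X_le_Phq hmn hX)

/-- `1 ≤ Φ` for `X ≥ 1`, `m + n ≥ 1`. [folklore] -/
theorem one_le_Phq (hmn : 1 ≤ m + n) {X : ℝ} (hX : 1 ≤ X) : 1 ≤ Phq m n X :=
  hX.trans (X_le_Phq hmn hX)

/-- `L · M ≤ a₁ Φ` and `L · M₁ ≤ a₁a₂ Φ` (`X > 1`). [folklore] -/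
theorem L_mul_M_le {X : ℝ} (hX : 1 < X) :
    (Lq m n X : ℝ) * Mq n X ≤ a1 m n * Phq m n X ∧
      (Lq m n X : ℝ) * M1q m n X ≤ a1 m n * a2 m n * Phq m n X := by
  have hL := L_le (m := m) (n := n) hX.le
  have hM := M_le (n := n) hX.le
  have e : scale m 0 X * scale n 0 X = Phq m n X := by
    rw [scale_mul_scale hX, Phq]
    congr 1
    ring
  have h1 : (Lq m n X : ℝ) * Mq n X ≤ a1 m n * Phq m n X := by
    calc (Lq m n X : ℝ) * Mq n X ≤ (a1 m n * scale m 0 X) * scale n 0 X :=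
          mul_le_mul hL hM (Nat.cast_nonneg _) (mul_nonneg (Nat.cast_nonneg _) (scale_nonneg hX.le))
      _ = a1 m n * Phq m n X := by rw [mul_assoc, e]
  refine ⟨h1, ?_⟩
  calc (Lq m n X : ℝ) * M1q m n X = a2 m n * ((Lq m n X : ℝ) * Mq n X) := by
        rw [M1_eq]; ring
    _ ≤ a2 m n * (a1 m n * Phq m n X) := mul_le_mul_of_nonneg_left h1 (Nat.cast_nonneg _)
    _ = a1 m n * a2 m n * Phq m n X := by ring

/-- **The degree bound `T₀ ≤ nm a₁ Φ`** (`X > 1`) for `D = 1`. [cite: Diaz1989, §II-3-3 (8) p. 11] -/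
theorem T0_le {X : ℝ} (hX : 1 < X) :
    (T0 m n 1 (Lq m n X) (Mq n X) : ℝ) ≤ (n * m * a1 m n) * Phq m n X := by
  have hLM := (L_mul_M_le (m := m) (n := n) hX).1
  have h1 : T0 m n 1 (Lq m n X) (Mq n X) ≤ n * m * (Lq m n X * Mq n X) := by
    unfold T0
    have : n * m * (Lq m n X * Mq n X - 1) ≤ n * m * (Lq m n X * Mq n X) :=
      Nat.mul_le_mul_left _ (Nat.sub_le _ _)
    omega
  have h1' : (T0 m n 1 (Lq m n X) (Mq n X) : ℝ) ≤ n * m * ((Lq m n X : ℝ) * Mq n X) := by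
    exact_mod_cast h1
  have hn0 : (0 : ℝ) ≤ n := Nat.cast_nonneg n
  have hm0 : (0 : ℝ) ≤ m := Nat.cast_nonneg m
  calc _ ≤ (n : ℝ) * m * ((Lq m n X : ℝ) * Mq n X) := h1'
    _ ≤ n * m * (a1 m n * Phq m n X) := mul_le_mul_of_nonneg_left hLM (mul_nonneg hn0 hm0)
    _ = (n * m * a1 m n) * Phq m n X := by ring

/-- **The degree bound `T₁(M₁) ≤ (1 + nm a₁a₂) Φ`** (`X > 1`, `m + n ≥ 1`) for `D = 1`.
[cite: Diaz1989, §II-3-3 (8) p. 11] -/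
theorem T1_le (hmn : 1 ≤ m + n) {X : ℝ} (hX : 1 < X) :
    (T1 m n 1 (Lq m n X) (M1q m n X) : ℝ) ≤ (1 + n * m * (a1 m n * a2 m n)) * Phq m n X := by
  have hLM := (L_mul_M_le (m := m) (n := n) hX).2
  have hΦ1 := one_le_Phq (m := m) (n := n) hmn hX.le
  unfold T1
  push_cast
  have hn0 : (0 : ℝ) ≤ n := Nat.cast_nonneg n
  have hm0 : (0 : ℝ) ≤ m := Nat.cast_nonneg m
  have h2 := mul_le_mul_of_nonneg_left hLM (mul_nonneg hn0 hm0)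
  nlinarith

/-! ### Crude sizes: everything polynomial in `X` is `≤ exp(Φ)` -/

/-- `X^K ≤ exp(Φ)` eventually, for every fixed `K` (`m + n > 0`). [folklore] -/
theorem eventually_scale_zero_le_exp_Phq (hmn : 0 < m + n) (K : ℝ) :
    ∀ᶠ X in atTop, scale K 0 X ≤ Real.exp (Phq m n X) := by
  have h := eventually_mul_scale_le_of_lt (a := 0) (a' := (m + n : ℕ)) (by exact_mod_cast hmn) 1 0 K
  filter_upwards [h, eventually_gt_atTop (1 : ℝ)] with X hX hX1
  rw [scale_zero_eq_exp K (by linarith)]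
  refine Real.exp_le_exp.mpr ?_
  rw [scale_zero_one] at hX
  rw [Phq]; push_cast at hX ⊢; exact hX

/-- Eventually `L ≤ X^{m+1}`, `M ≤ Xⁿ`, `M₁ ≤ X^{n+1}` (as scales). [folklore] -/
theorem eventually_crude :
    ∀ᶠ X in atTop, (Lq m n X : ℝ) ≤ scale (m + 1) 0 X ∧
      (Mq n X : ℝ) ≤ scale n 0 X ∧ (M1q m n X : ℝ) ≤ scale (n + 1) 0 X := by
  have hL := eventually_mul_scale_le_of_lt (a := (m : ℝ)) (a' := m + 1) (by linarith) 0 0 (a1 m n)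
  have hM1 := eventually_mul_scale_le_of_lt (a := (n : ℝ)) (a' := n + 1) (by linarith) 0 0 (a2 m n)
  filter_upwards [hL, hM1, eventually_ge_atTop (1 : ℝ)] with X hXL hXM1 hX1
  refine ⟨(L_le hX1).trans hXL, M_le hX1, ?_⟩
  calc (M1q m n X : ℝ) = a2 m n * Mq n X := M1_eq X
    _ ≤ a2 m n * scale n 0 X := mul_le_mul_of_nonneg_left (M_le hX1) (Nat.cast_nonneg _)
    _ ≤ scale (n + 1) 0 X := hXM1

/-- **Cardinalities are `≤ exp(Φ)` eventually**: `#DL`, `#ExpIdx`, `#Unk`, `Mᵐ` (`D = 1`,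
`m + n ≥ 1`). [folklore] -/
theorem eventually_cards_le (hmn : 0 < m + n) :
    ∀ᶠ X in atTop,
      (Fintype.card (DL n 1 (Lq m n X)) : ℝ) ≤ Real.exp (Phq m n X) ∧
      (Fintype.card (ExpIdx m n 1 (Lq m n X) (Mq n X)) : ℝ) ≤ Real.exp (Phq m n X) ∧
      (Fintype.card (Unk m n 1 (Lq m n X) (Mq n X)) : ℝ) ≤ Real.exp (Phq m n X) ∧
      (Mq n X : ℝ) ^ m ≤ Real.exp (Phq m n X) := by
  filter_upwards [eventually_crude (m := m) (n := n), eventually_gt_atTop (1 : ℝ),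
    eventually_scale_zero_le_exp_Phq (m := m) (n := n) hmn ((m + 1) * n),
    eventually_scale_zero_le_exp_Phq (m := m) (n := n) hmn (((m + 1) + n) * (n * m)),
    eventually_scale_zero_le_exp_Phq (m := m) (n := n) hmn
      (((m + 1) * n) + (((m + 1) + n) * (n * m))),
    eventually_scale_zero_le_exp_Phq (m := m) (n := n) hmn (n * m)]
    with X hcr hX1 h1 h2 h3 h4
  obtain ⟨hL, hM, -⟩ := hcr
  have hL0 : (0 : ℝ) ≤ Lq m n X := Nat.cast_nonneg _
  have hM0 : (0 : ℝ) ≤ Mq n X := Nat.cast_nonneg _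
  -- `#DL = 1 · Lⁿ`
  have cDL : (Fintype.card (DL n 1 (Lq m n X)) : ℝ) ≤ scale ((m + 1) * n) 0 X := by
    have : (Fintype.card (DL n 1 (Lq m n X)) : ℝ) = (Lq m n X : ℝ) ^ n := by
      simp [Fintype.card_prod, Fintype.card_fin, Fintype.card_pi]
    rw [this]
    calc (Lq m n X : ℝ) ^ n ≤ scale (m + 1) 0 X ^ n := pow_le_pow_left₀ hL0 hL n
      _ = scale ((m + 1) * n) 0 X := by rw [scale_pow hX1.le]; simp
  -- `#ExpIdx = 1^m (LM)^{nm}`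
  have cE : (Fintype.card (ExpIdx m n 1 (Lq m n X) (Mq n X)) : ℝ) ≤
      scale (((m + 1) + n) * (n * m)) 0 X := by
    have : (Fintype.card (ExpIdx m n 1 (Lq m n X) (Mq n X)) : ℝ) =
        ((Lq m n X : ℝ) * Mq n X) ^ (n * m) := by
      simp [Fintype.card_prod, Fintype.card_fin, Fintype.card_pi]
    rw [this]
    calc ((Lq m n X : ℝ) * Mq n X) ^ (n * m) ≤ (scale (m + 1) 0 X * scale n 0 X) ^ (n * m) :=
          pow_le_pow_left₀ (by positivity) (mul_le_mul hL hM hM0 (scale_nonneg hX1.le)) _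
      _ = scale (((m + 1) + n) * (n * m)) 0 X := by
          rw [scale_mul_scale hX1, scale_pow hX1.le]; simp
  refine ⟨cDL.trans h1, cE.trans h2, ?_, ?_⟩
  · have : (Fintype.card (Unk m n 1 (Lq m n X) (Mq n X)) : ℝ) =
        (Fintype.card (DL n 1 (Lq m n X)) : ℝ) *
          Fintype.card (ExpIdx m n 1 (Lq m n X) (Mq n X)) := by
      rw [Fintype.card_prod]; push_cast; rfl
    rw [this]
    calc _ ≤ scale ((m + 1) * n) 0 X * scale (((m + 1) + n) * (n * m)) 0 X :=
          mul_le_mul cDL cE (Nat.cast_nonneg _) (scale_nonneg hX1.le)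
      _ = scale (((m + 1) * n) + (((m + 1) + n) * (n * m))) 0 X := by
          rw [scale_mul_scale hX1]; simp
      _ ≤ _ := h3
  · calc (Mq n X : ℝ) ^ m ≤ scale n 0 X ^ m := pow_le_pow_left₀ hM0 hM m
      _ = scale (n * m) 0 X := by rw [scale_pow hX1.le]; simp
      _ ≤ _ := h4

/-! ### The height of Siegel's step and the bound `Pmax` -/

/-- The height bound `H = #Unk · (mM)¹` of Siegel's step (`DiazThm1.exists_coeffs` with `D = 1`) for
the parameters at `X`. [cite: Diaz1989, §II-2 (1) p. 5] -/
def Hq (m n : ℕ) (X : ℝ) : ℝ :=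
  Fintype.card (Unk m n 1 (Lq m n X) (Mq n X)) * ((m : ℝ) * Mq n X) ^ (1 : ℕ)

/-- `log M ≤ n log X` (`X ≥ 1`, `M ≥ 1`). [folklore] -/
theorem log_M_le {X : ℝ} (hX : 1 ≤ X) (hM : 1 ≤ Mq n X) :
    Real.log (Mq n X) ≤ n * Real.log X := by
  have hMpos : (0 : ℝ) < Mq n X := by exact_mod_cast (show 0 < Mq n X by omega)
  calc Real.log (Mq n X) ≤ Real.log (scale n 0 X) := Real.log_le_log hMpos (M_le hX)
    _ = n * Real.log X := by
        rw [scale, Real.rpow_zero, mul_one, Real.log_rpow (by linarith)]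

/-- `log (mM) ≤ (n+2) log X` for `X ≥ m`, `X > 1`, `M ≥ 1`, `m ≥ 1`. [folklore] -/
theorem log_mM_le (hm : 1 ≤ m) {X : ℝ} (hX : 1 < X) (hXm : (m : ℝ) ≤ X) (hM : 1 ≤ Mq n X) :
    Real.log ((m : ℝ) * Mq n X) ≤ (n + 2) * Real.log X := by
  have hmpos : (0 : ℝ) < m := by exact_mod_cast (show 0 < m by omega)
  have hMpos : (0 : ℝ) < Mq n X := by exact_mod_cast (show 0 < Mq n X by omega)
  rw [Real.log_mul hmpos.ne' hMpos.ne']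
  have h1 : Real.log m ≤ Real.log X := Real.log_le_log hmpos hXm
  have h2 := log_M_le (n := n) hX.le hM
  have h3 : 0 ≤ Real.log X := Real.log_nonneg hX.le
  linarith

/-- **`1 ≤ H ≤ exp((n+3)Φ)` eventually** (`m, n ≥ 1`). [cite: Diaz1989, §II-2 (1) p. 5] -/
theorem eventually_Hq_le (hm : 1 ≤ m) (hn : 1 ≤ n) :
    ∀ᶠ X in atTop, 1 ≤ Hq m n X ∧ Hq m n X ≤ Real.exp ((n + 3) * Phq m n X) := by
  filter_upwards [eventually_cards_le (m := m) (n := n) (by omega), eventually_M_ge (n := n) hn,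
    eventually_L_ge (m := m) (n := n) hm, eventually_ge_atTop (m : ℝ), eventually_gt_atTop (1 : ℝ)]
    with X hcards hM hL hXm hX1
  obtain ⟨-, -, hU, -⟩ := hcards
  have hM2 : (2 : ℝ) ≤ Mq n X := by exact_mod_cast hM.2
  have hm1 : (1 : ℝ) ≤ m := by exact_mod_cast hm
  have hmM : (1 : ℝ) ≤ (m : ℝ) * Mq n X := by nlinarith
  have hcard1 : (1 : ℝ) ≤ Fintype.card (Unk m n 1 (Lq m n X) (Mq n X)) := by
    have : 0 < Fintype.card (Unk m n 1 (Lq m n X) (Mq n X)) := by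
      rw [card_Unk]
      have := hM.2; have := hL.2
      positivity
    exact_mod_cast this
  have hpow1 : (1 : ℝ) ≤ ((m : ℝ) * Mq n X) ^ (1 : ℕ) := by rw [pow_one]; exact hmM
  refine ⟨by unfold Hq; nlinarith, ?_⟩
  have hlogmM := log_mM_le (n := n) hm hX1 hXm (by have := hM.2; omega)
  have hpow : ((m : ℝ) * Mq n X) ^ (1 : ℕ) ≤ Real.exp ((n + 2) * Phq m n X) := by
    rw [pow_one, ← Real.exp_log (show (0 : ℝ) < (m : ℝ) * Mq n X by positivity)]
    refine Real.exp_le_exp.mpr ?_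
    calc Real.log ((m : ℝ) * Mq n X) ≤ (n + 2) * Real.log X := hlogmM
      _ ≤ (n + 2) * Phq m n X :=
          mul_le_mul_of_nonneg_left (log_le_Phq (by omega) hX1.le) (by positivity)
  unfold Hq
  calc _ ≤ Real.exp (Phq m n X) * Real.exp ((n + 2) * Phq m n X) :=
        mul_le_mul hU hpow (by positivity) (by positivity)
    _ = Real.exp ((n + 3) * Phq m n X) := by rw [← Real.exp_add]; ring_nf

/-- The constant `K_P(A) = nm a₁ (log 2 + log A) + n + 4` in `Pmax ≤ exp(K_P Φ)`. [folklore] -/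
def KPq (m n : ℕ) (A : ℝ) : ℝ := (n * m * a1 m n) * (Real.log 2 + Real.log A) + n + 4

/-- **`Pmax ≤ exp(K_P(A) Φ)` eventually** for every `A ≥ 1`. [cite: Diaz1989, §II-3-2 (3) p. 8] -/
theorem eventually_Pmax_le (hm : 1 ≤ m) (hn : 1 ≤ n) {A : ℝ} (hA : 1 ≤ A) :
    ∀ᶠ X in atTop, Pmax m n 1 (Lq m n X) (Mq n X) (Hq m n X) A ≤
      Real.exp (KPq m n A * Phq m n X) := by
  filter_upwards [eventually_cards_le (m := m) (n := n) (by omega), eventually_Hq_le (n := n) hm hn,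
    eventually_gt_atTop (1 : ℝ)] with X hcards hH hX1
  obtain ⟨-, hE, -, -⟩ := hcards
  have hT0 := T0_le (m := m) (n := n) hX1
  have hΦ := Phq_nonneg (m := m) (n := n) hX1.le
  have hl2 : 0 ≤ Real.log 2 + Real.log A := by
    have := Real.log_nonneg (show (1:ℝ) ≤ 2 by norm_num); have := Real.log_nonneg hA; linarith
  set T : ℝ := (T0 m n 1 (Lq m n X) (Mq n X) : ℝ) with hT
  have h2T : (2 : ℝ) ^ T0 m n 1 (Lq m n X) (Mq n X) = Real.exp (T * Real.log 2) := by
    rw [← Real.exp_log (pow_pos two_pos _), Real.log_pow, hT]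
  have hAT : A ^ T0 m n 1 (Lq m n X) (Mq n X) = Real.exp (T * Real.log A) := by
    rw [← Real.exp_log (pow_pos (by linarith) _), Real.log_pow, hT]
  unfold Pmax
  rw [h2T, hAT]
  calc Real.exp (T * Real.log 2) *
        ((Fintype.card (ExpIdx m n 1 (Lq m n X) (Mq n X)) : ℝ) * Hq m n X) *
        Real.exp (T * Real.log A)
      ≤ Real.exp (T * Real.log 2) * (Real.exp (Phq m n X) * Real.exp ((n + 3) * Phq m n X)) *
        Real.exp (T * Real.log A) := by
        refine mul_le_mul_of_nonneg_right (mul_le_mul_of_nonneg_left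
          (mul_le_mul hE hH.2 (by linarith [hH.1]) (by positivity)) (by positivity)) (by positivity)
    _ = Real.exp (T * (Real.log 2 + Real.log A) + (n + 4) * Phq m n X) := by
        rw [← Real.exp_add, ← Real.exp_add, ← Real.exp_add]; ring_nf
    _ ≤ Real.exp (KPq m n A * Phq m n X) := by
        refine Real.exp_le_exp.mpr ?_
        unfold KPq
        have := mul_le_mul_of_nonneg_right hT0 hl2
        nlinarith

/-! ### The bounds `ε₁`, `T_A`, `B_R`, `Λ` for the chosen parameters -/

/-- `1 ≤ mM` and `(mM)¹ ≤ exp((n+2)Φ)` eventually (`m, n ≥ 1`). [folklore] -/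
theorem eventually_pow_mM_le (hm : 1 ≤ m) (hn : 1 ≤ n) :
    ∀ᶠ X in atTop, (1 : ℝ) ≤ (m : ℝ) * Mq n X ∧
      ((m : ℝ) * Mq n X) ^ (1 : ℕ) ≤ Real.exp ((n + 2) * Phq m n X) := by
  filter_upwards [eventually_M_ge (n := n) hn, eventually_ge_atTop (m : ℝ), eventually_gt_atTop (1 : ℝ)]
    with X hM hXm hX1
  have hM2 : (2 : ℝ) ≤ Mq n X := by exact_mod_cast hM.2
  have hm1 : (1 : ℝ) ≤ m := by exact_mod_cast hm
  have hmM : (1 : ℝ) ≤ (m : ℝ) * Mq n X := by nlinarith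
  refine ⟨hmM, ?_⟩
  have hlogmM := log_mM_le (n := n) hm hX1 hXm (by have := hM.2; omega)
  rw [pow_one, ← Real.exp_log (show (0 : ℝ) < (m : ℝ) * Mq n X by positivity)]
  refine Real.exp_le_exp.mpr ?_
  calc Real.log ((m : ℝ) * Mq n X) ≤ (n + 2) * Real.log X := hlogmM
    _ ≤ (n + 2) * Phq m n X :=
        mul_le_mul_of_nonneg_left (log_le_Phq (by omega) hX1.le) (by positivity)

/-- `T₁(M) ≤ (1 + nm a₁) Φ` (`X > 1`, `m + n ≥ 1`). [folklore] -/
theorem T1_M_le (hmn : 1 ≤ m + n) {X : ℝ} (hX : 1 < X) :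
    (T1 m n 1 (Lq m n X) (Mq n X) : ℝ) ≤ (1 + n * m * a1 m n) * Phq m n X := by
  have hLM := (L_mul_M_le (m := m) (n := n) hX).1
  have hΦ1 := one_le_Phq (m := m) (n := n) hmn hX.le
  unfold T1
  push_cast
  have hn0 : (0 : ℝ) ≤ n := Nat.cast_nonneg n
  have hm0 : (0 : ℝ) ≤ m := Nat.cast_nonneg m
  have h2 := mul_le_mul_of_nonneg_left hLM (mul_nonneg hn0 hm0)
  nlinarith

/-- The constant `K_ε(A) = K_P(A) + n + 3 + (1 + nm a₁)(1 + log A)`. [folklore] -/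
def Kepsq (m n : ℕ) (A : ℝ) : ℝ := KPq m n A + n + 3 + (1 + n * m * a1 m n) * (1 + Real.log A)

/-- **`ε₁ ≤ exp(K_ε Φ - ρ)` eventually** (the analogue of Diaz's (5)). [cite: Diaz1989, §II-3-2 (b) (5) p. 9] -/
theorem eventually_eps1_le (hm : 1 ≤ m) (hn : 1 ≤ n) {A : ℝ} (hA : 1 ≤ A) :
    ∀ᶠ X in atTop, eps1 m n 1 (Lq m n X) (Mq n X) (Hq m n X) A (Real.exp (-rhoq m n X)) ≤
      Real.exp (Kepsq m n A * Phq m n X - rhoq m n X) := by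
  filter_upwards [eventually_cards_le (m := m) (n := n) (by omega), eventually_Pmax_le (n := n) hm hn hA,
    eventually_pow_mM_le (n := n) hm hn, eventually_gt_atTop (1 : ℝ),
    eventually_Hq_le (n := n) hm hn] with X hcards hP hmM hX1 hH
  obtain ⟨hDL, -, -, -⟩ := hcards
  have hΦ := Phq_nonneg (m := m) (n := n) hX1.le
  have hT1 := T1_M_le (m := m) (n := n) (by omega) hX1
  have hlA : 0 ≤ Real.log A := Real.log_nonneg hA
  set T : ℝ := (T1 m n 1 (Lq m n X) (Mq n X) : ℝ) with hT
  have hT0 : 0 ≤ T := Nat.cast_nonneg _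
  have hAT : A ^ T1 m n 1 (Lq m n X) (Mq n X) = Real.exp (T * Real.log A) := by
    rw [← Real.exp_log (pow_pos (by linarith) _), Real.log_pow, hT]
  have hTexp : T ≤ Real.exp T := le_exp_self T
  unfold eps1
  rw [hAT]
  have hPmax0 : 0 ≤ Pmax m n 1 (Lq m n X) (Mq n X) (Hq m n X) A :=
    Pmax_nonneg (by linarith [hH.1]) (by linarith)
  calc _ ≤ Real.exp (Phq m n X) * Real.exp (KPq m n A * Phq m n X) *
        (Real.exp ((n + 2) * Phq m n X) * Real.exp T * Real.exp (T * Real.log A) *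
          Real.exp (-rhoq m n X)) := by
        refine mul_le_mul (mul_le_mul hDL hP hPmax0 (by positivity)) ?_ (by positivity) (by positivity)
        refine mul_le_mul_of_nonneg_right ?_ (by positivity)
        exact mul_le_mul (mul_le_mul hmM.2 hTexp hT0 (by positivity)) le_rfl (by positivity)
          (by positivity)
    _ = Real.exp ((KPq m n A + n + 3) * Phq m n X + T * (1 + Real.log A) - rhoq m n X) := by
        simp only [← Real.exp_add]; ring_nf
    _ ≤ Real.exp (Kepsq m n A * Phq m n X - rhoq m n X) := by
        refine Real.exp_le_exp.mpr ?_
        unfold Kepsq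
        have := mul_le_mul_of_nonneg_right hT1 (show 0 ≤ 1 + Real.log A by linarith)
        nlinarith

/-- The constant `K_A = 1 + K_P + nm a₁ + (n + 3) + U V a₁ a₂` in `T_A ≤ exp(K_A Φ - ρ)`. [folklore] -/
def KAq (m n : ℕ) (A U V : ℝ) : ℝ :=
  1 + KPq m n A + (n * m * a1 m n) + (n + 3) + U * V * (a1 m n * a2 m n)

/-- **`T_A ≤ exp(K_A Φ - ρ)` eventually** (the analogue of Diaz's (4)). [cite: Diaz1989, §II-3-2 (a) (4) p. 8] -/
theorem eventually_TAb_le (hm : 1 ≤ m) (hn : 1 ≤ n) {A U V : ℝ} (hA : 1 ≤ A) (hU : 0 ≤ U) (hV : 0 ≤ V) :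
    ∀ᶠ X in atTop, TAb m n 1 (Lq m n X) (Mq n X) (Hq m n X) A (Real.exp (-rhoq m n X))
        (M1q m n X) U V ≤ Real.exp (KAq m n A U V * Phq m n X - rhoq m n X) := by
  filter_upwards [eventually_cards_le (m := m) (n := n) (by omega), eventually_Pmax_le (n := n) hm hn hA,
    eventually_Hq_le (n := n) hm hn, eventually_crude (m := m) (n := n), eventually_M_ge (n := n) hn,
    eventually_ge_atTop (V + 1), eventually_gt_atTop (1 : ℝ)]
    with X hcards hP hH hcr hM hXV hX1
  obtain ⟨hDL, -, -, -⟩ := hcards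
  obtain ⟨-, -, hM1⟩ := hcr
  have hΦ := Phq_nonneg (m := m) (n := n) hX1.le
  have hT0 := T0_le (m := m) (n := n) hX1
  have hLM := (L_mul_M_le (m := m) (n := n) hX1).2
  have hPmax0 : 0 ≤ Pmax m n 1 (Lq m n X) (Mq n X) (Hq m n X) A :=
    Pmax_nonneg (by linarith [hH.1]) (by linarith)
  have hM1ge1 : (1 : ℝ) ≤ M1q m n X := by
    exact_mod_cast one_le_M1 (m := m) (n := n) (X := X) (by have := hM.2; omega)
  set T : ℝ := (T0 m n 1 (Lq m n X) (Mq n X) : ℝ) with hT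
  -- `(1 + M₁V)^1 ≤ exp((n+3)Φ)`
  have hbase : (1 : ℝ) ≤ 1 + M1q m n X * V := by nlinarith
  have hlogb : Real.log (1 + M1q m n X * V) ≤ (n + 2) * Real.log X := by
    have h1 : 1 + (M1q m n X : ℝ) * V ≤ scale (n + 1) 0 X * X := by
      calc 1 + (M1q m n X : ℝ) * V ≤ M1q m n X * (V + 1) := by nlinarith
        _ ≤ scale (n + 1) 0 X * X := mul_le_mul hM1 hXV (by linarith) (scale_nonneg hX1.le)
    calc Real.log (1 + M1q m n X * V) ≤ Real.log (scale (n + 1) 0 X * X) :=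
          Real.log_le_log (by linarith) h1
      _ = (n + 2) * Real.log X := by
          rw [Real.log_mul (scale_pos hX1).ne' (by linarith), scale, Real.rpow_zero, mul_one,
            Real.log_rpow (by linarith)]; ring
  have hpowD : (1 + (M1q m n X : ℝ) * V) ^ (1 : ℕ) ≤ Real.exp ((n + 3) * Phq m n X) := by
    rw [pow_one, ← Real.exp_log (show (0 : ℝ) < 1 + (M1q m n X : ℝ) * V by linarith)]
    refine Real.exp_le_exp.mpr ?_
    have hlog0 : 0 ≤ Real.log X := Real.log_nonneg hX1.le
    calc Real.log (1 + M1q m n X * V) ≤ (n + 2) * Real.log X := hlogb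
      _ ≤ (n + 3) * Real.log X := by nlinarith
      _ ≤ (n + 3) * Phq m n X :=
          mul_le_mul_of_nonneg_left (log_le_Phq (by omega) hX1.le) (by positivity)
  have hexpL : Real.exp ((Lq m n X : ℝ) * U * ((M1q m n X : ℝ) * V)) ≤
      Real.exp (U * V * (a1 m n * a2 m n) * Phq m n X) := by
    refine Real.exp_le_exp.mpr ?_
    have := mul_le_mul_of_nonneg_left hLM (mul_nonneg hU hV)
    nlinarith
  have hTexp : T ≤ Real.exp T := le_exp_self T
  unfold TAb
  calc _ ≤ Real.exp (Phq m n X) * (Real.exp (KPq m n A * Phq m n X) * Real.exp T *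
          Real.exp (-rhoq m n X)) * (Real.exp ((n + 3) * Phq m n X) *
          Real.exp (U * V * (a1 m n * a2 m n) * Phq m n X)) := by
        refine mul_le_mul (mul_le_mul hDL ?_ (by positivity) (by positivity))
          (mul_le_mul hpowD hexpL (by positivity) (by positivity)) (by positivity) (by positivity)
        exact mul_le_mul (mul_le_mul hP hTexp (by positivity) (by positivity)) le_rfl
          (by positivity) (by positivity)
    _ = Real.exp ((1 + KPq m n A + (n + 3) + U * V * (a1 m n * a2 m n)) * Phq m n X + T -
          rhoq m n X) := by simp only [← Real.exp_add]; ring_nf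
    _ ≤ Real.exp (KAq m n A U V * Phq m n X - rhoq m n X) := by
        refine Real.exp_le_exp.mpr ?_
        unfold KAq
        nlinarith

/-- The radius `R = 8 r X^{mn-m-n}` of the big circle (`r = M₁(V+1)`); the exponent `mn - m - n ≥ 1`
is the room left by the hypothesis `mn > m + n` of Théorème 2. [cite: Diaz1989, Théorème 2 p. 2 (our parameters; cf. §II-4-1 p. 15)] -/
def Rbq (m n : ℕ) (V X : ℝ) : ℝ := 8 * ((M1q m n X : ℝ) * (V + 1)) * X ^ (m * n - (m + n))

/-- The constant `K_B = 1 + K_P + (mn + 7)` in `B_R ≤ exp(K_B Φ + K_R X^{mn})`, where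
`K_R = 8U(V+1)a₁a₂` is the constant `DiazThm1.KR` of `DiazSmallness.lean`. [folklore] -/
def KBq (m n : ℕ) (A : ℝ) : ℝ := 1 + KPq m n A + (m * n + 7)

/-- **`B_R ≤ exp(K_B Φ + K_R X^{mn})` eventually** (`|F̃|_R ≤ exp c(log R + LR)`), for
`mn ≥ m + n`. [cite: Diaz1989, §II-3-2 (c) p. 10] -/
theorem eventually_Bgr_le (hm : 1 ≤ m) (hn : 1 ≤ n) (hmn : m + n ≤ m * n) {A U V : ℝ} (hA : 1 ≤ A)
    (hU : 0 ≤ U) (hV : 0 ≤ V) :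
    ∀ᶠ X in atTop, Bgr m n 1 (Lq m n X) (Mq n X) (Hq m n X) A U (Rbq m n V X) ≤
      Real.exp (KBq m n A * Phq m n X + KR m n U V * scale (m * n) 0 X) := by
  filter_upwards [eventually_cards_le (m := m) (n := n) (by omega), eventually_Pmax_le (n := n) hm hn hA,
    eventually_Hq_le (n := n) hm hn, eventually_crude (m := m) (n := n), eventually_M_ge (n := n) hn,
    eventually_ge_atTop (max 8 (V + 1)), eventually_gt_atTop (1 : ℝ)]
    with X hcards hP hH hcr hM hXmax hX1
  obtain ⟨hDL, -, -, -⟩ := hcards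
  obtain ⟨-, -, hM1⟩ := hcr
  have hX8 : 8 ≤ X := le_trans (le_max_left _ _) hXmax
  have hXV : V + 1 ≤ X := le_trans (le_max_right _ _) hXmax
  have hlog0 : 0 ≤ Real.log X := Real.log_nonneg hX1.le
  have hΦ := Phq_nonneg (m := m) (n := n) hX1.le
  have hLM := (L_mul_M_le (m := m) (n := n) hX1).2
  have hPmax0 : 0 ≤ Pmax m n 1 (Lq m n X) (Mq n X) (Hq m n X) A :=
    Pmax_nonneg (by linarith [hH.1]) (by linarith)
  have hM1ge1 : (1 : ℝ) ≤ M1q m n X := by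
    exact_mod_cast one_le_M1 (m := m) (n := n) (X := X) (by have := hM.2; omega)
  have hXk : (1 : ℝ) ≤ X ^ (m * n - (m + n)) := one_le_pow₀ hX1.le
  have hr1 : (1 : ℝ) ≤ (M1q m n X : ℝ) * (V + 1) := by nlinarith
  have hR1 : (1 : ℝ) ≤ Rbq m n V X := by unfold Rbq; nlinarith
  have hmax : max 1 (Rbq m n V X) = Rbq m n V X := max_eq_right hR1
  -- `log R ≤ (mn + 7) log X`
  have hlogR : Real.log (Rbq m n V X) ≤ (m * n + 7) * Real.log X := by
    have h8 : Real.log 8 ≤ Real.log X := Real.log_le_log (by norm_num) hX8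
    have hr : Real.log ((M1q m n X : ℝ) * (V + 1)) ≤ (n + 2) * Real.log X := by
      calc Real.log ((M1q m n X : ℝ) * (V + 1)) ≤ Real.log (scale (n + 1) 0 X * X) :=
            Real.log_le_log (by positivity) (mul_le_mul hM1 hXV (by linarith) (scale_nonneg hX1.le))
        _ = (n + 2) * Real.log X := by
            rw [Real.log_mul (scale_pos hX1).ne' (by linarith), scale, Real.rpow_zero, mul_one,
              Real.log_rpow (by linarith)]; ring
    have hk : Real.log (X ^ (m * n - (m + n))) = ((m * n - (m + n) : ℕ) : ℝ) * Real.log X := by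
      rw [Real.log_pow]
    unfold Rbq
    rw [Real.log_mul (by positivity) (by positivity), Real.log_mul (by norm_num) (by positivity), hk]
    have h1 : ((m * n - (m + n) : ℕ) : ℝ) * Real.log X = ((m * n : ℝ) - (m + n)) * Real.log X := by
      rw [Nat.cast_sub hmn]; push_cast; ring
    rw [h1]
    have hm0 : (0 : ℝ) ≤ m := Nat.cast_nonneg m
    nlinarith [h8, hr, hlog0]
  have hpowD : (max 1 (Rbq m n V X)) ^ (1 : ℕ) ≤ Real.exp ((m * n + 7) * Phq m n X) := by
    rw [hmax, pow_one, ← Real.exp_log (show (0 : ℝ) < Rbq m n V X by linarith)]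
    refine Real.exp_le_exp.mpr ?_
    calc Real.log (Rbq m n V X) ≤ (m * n + 7) * Real.log X := hlogR
      _ ≤ (m * n + 7) * Phq m n X :=
          mul_le_mul_of_nonneg_left (log_le_Phq (by omega) hX1.le) (by positivity)
  -- `L U R ≤ K_R scale(mn, 0)`
  have hscale : Phq m n X * X ^ (m * n - (m + n)) = scale (m * n) 0 X := by
    have : (X : ℝ) ^ (m * n - (m + n)) = scale ((m * n - (m + n) : ℕ) : ℝ) 0 X := by
      rw [scale, Real.rpow_zero, mul_one, Real.rpow_natCast]
    rw [this, Phq, scale_mul_scale hX1]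
    congr 1
    · push_cast [Nat.cast_sub hmn]; ring
    · ring
  have hLUR : (Lq m n X : ℝ) * U * Rbq m n V X ≤ KR m n U V * scale (m * n) 0 X := by
    unfold Rbq KR
    rw [← hscale]
    have := mul_le_mul_of_nonneg_left hLM (show 0 ≤ 8 * U * (V + 1) * X ^ (m * n - (m + n)) by positivity)
    nlinarith [this]
  unfold Bgr
  calc _ ≤ Real.exp (Phq m n X) * Real.exp (KPq m n A * Phq m n X) *
        (Real.exp ((m * n + 7) * Phq m n X) *
          Real.exp (KR m n U V * scale (m * n) 0 X)) := by
        refine mul_le_mul (mul_le_mul hDL hP hPmax0 (by positivity))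
          (mul_le_mul hpowD (Real.exp_le_exp.mpr hLUR) (by positivity) (by positivity))
          (by positivity) (by positivity)
    _ = Real.exp (KBq m n A * Phq m n X + KR m n U V * scale (m * n) 0 X) := by
        simp only [← Real.exp_add]; unfold KBq; ring_nf

/-! ### `Λ`, the powers of `r`, and the geometric factor `(2r/(R-r))^{M^m}` -/

/-- **`Λ ≥ exp(-(n+2)Ψ)` eventually**: for `0 < ω ≤ 1` (`ω = min(1,|v_m|/2)`) and
`δ(M) = exp(-M log M)`, `(δ ω^M)^{M^{m'}} ≥ exp(-(n+2) X^{(m'+1)n} log X)` (`n ≥ 1`). [folklore] -/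
theorem eventually_Lam_ge {m' : ℕ} (hn : 1 ≤ n) {ω : ℝ} (hω0 : 0 < ω) (hω1 : ω ≤ 1) :
    ∀ᶠ X in atTop, Real.exp (-((n + 2) * Psq (m' + 1) n X)) ≤
      (Real.exp (-((Mq n X : ℝ) * Real.log (Mq n X))) * ω ^ Mq n X) ^ (Mq n X ^ m') := by
  filter_upwards [eventually_M_ge (n := n) hn, eventually_ge_atTop (ω⁻¹), eventually_gt_atTop (1 : ℝ)]
    with X hM hXω hX1
  have hM1 : 1 ≤ Mq n X := by have := hM.2; omega
  have hMr : (1 : ℝ) ≤ Mq n X := by exact_mod_cast hM1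
  have hlogM := log_M_le (n := n) hX1.le hM1
  have hlogω : -Real.log ω ≤ Real.log X := by
    rw [← Real.log_inv]
    exact Real.log_le_log (inv_pos.mpr hω0) hXω
  have hlog0 : 0 ≤ Real.log X := Real.log_nonneg hX1.le
  have hωM : ω ^ Mq n X = Real.exp ((Mq n X : ℝ) * Real.log ω) := by
    rw [← Real.exp_log (pow_pos hω0 _), Real.log_pow]
  rw [hωM, ← Real.exp_add, ← Real.exp_nat_mul]
  refine Real.exp_le_exp.mpr ?_
  have hMm : ((Mq n X ^ m' : ℕ) : ℝ) * (Mq n X : ℝ) ≤ scale ((m' + 1) * n) 0 X := by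
    have hMle := M_le (n := n) hX1.le
    calc ((Mq n X ^ m' : ℕ) : ℝ) * (Mq n X : ℝ) = (Mq n X : ℝ) ^ (m' + 1) := by push_cast; ring
      _ ≤ scale n 0 X ^ (m' + 1) := pow_le_pow_left₀ (Nat.cast_nonneg _) hMle _
      _ = scale ((m' + 1) * n) 0 X := by rw [scale_pow hX1.le]; push_cast; ring_nf
  have hΨ : scale ((m' + 1) * n) 0 X * Real.log X = Psq (m' + 1) n X := by
    rw [Psq, ← scale_zero_one, scale_mul_scale hX1]; push_cast; ring_nf
  have hpos : 0 ≤ Real.log (Mq n X) - Real.log ω := by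
    have := Real.log_nonneg hMr; have := Real.log_nonpos hω0.le hω1; linarith
  have hn0 : (0 : ℝ) ≤ n := Nat.cast_nonneg n
  have key : ((Mq n X ^ m' : ℕ) : ℝ) * (Mq n X : ℝ) * (Real.log (Mq n X) - Real.log ω) ≤
      (n + 2) * Psq (m' + 1) n X := by
    calc ((Mq n X ^ m' : ℕ) : ℝ) * (Mq n X : ℝ) * (Real.log (Mq n X) - Real.log ω)
        ≤ scale ((m' + 1) * n) 0 X * ((n + 2) * Real.log X) :=
          mul_le_mul hMm (by nlinarith) hpos (scale_nonneg hX1.le)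
      _ = (n + 2) * Psq (m' + 1) n X := by rw [← hΨ]; ring
  nlinarith [key]

/-- **`(c·r)^{M^m - 1} ≤ exp((n+4)Ψ)` eventually** for `1 ≤ c ≤ 8`, `r = M₁(V+1)` (`n ≥ 1`). [folklore] -/
theorem eventually_rpow_le (hn : 1 ≤ n) {V c : ℝ} (hV : 0 ≤ V) (hc : 1 ≤ c) (hc8 : c ≤ 8) :
    ∀ᶠ X in atTop, (c * ((M1q m n X : ℝ) * (V + 1))) ^ (Mq n X ^ m - 1) ≤
      Real.exp ((n + 4) * Psq m n X) := by
  filter_upwards [eventually_crude (m := m) (n := n), eventually_M_ge (n := n) hn,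
    eventually_ge_atTop (max 8 (V + 1)), eventually_gt_atTop (1 : ℝ)]
    with X hcr hM hXmax hX1
  obtain ⟨-, -, hM1⟩ := hcr
  have hX8 : 8 ≤ X := le_trans (le_max_left _ _) hXmax
  have hXV : V + 1 ≤ X := le_trans (le_max_right _ _) hXmax
  have hlog0 : 0 ≤ Real.log X := Real.log_nonneg hX1.le
  have hM1ge1 : (1 : ℝ) ≤ M1q m n X := by
    exact_mod_cast one_le_M1 (m := m) (n := n) (X := X) (by have := hM.2; omega)
  set b : ℝ := c * ((M1q m n X : ℝ) * (V + 1)) with hb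
  have hr1 : (1 : ℝ) ≤ (M1q m n X : ℝ) * (V + 1) := by nlinarith
  have hb1 : 1 ≤ b := by rw [hb]; nlinarith
  have hlogb : Real.log b ≤ (n + 4) * Real.log X := by
    have hc' : Real.log c ≤ Real.log X := Real.log_le_log (by linarith) (by linarith)
    have hr : Real.log ((M1q m n X : ℝ) * (V + 1)) ≤ (n + 2) * Real.log X := by
      calc Real.log ((M1q m n X : ℝ) * (V + 1)) ≤ Real.log (scale (n + 1) 0 X * X) :=
            Real.log_le_log (by positivity) (mul_le_mul hM1 hXV (by linarith) (scale_nonneg hX1.le))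
        _ = (n + 2) * Real.log X := by
            rw [Real.log_mul (scale_pos hX1).ne' (by linarith), scale, Real.rpow_zero, mul_one,
              Real.log_rpow (by linarith)]; ring
    rw [hb, Real.log_mul (by linarith) (by positivity)]
    linarith
  have hMm : ((Mq n X ^ m : ℕ) : ℝ) ≤ scale (m * n) 0 X := by
    calc ((Mq n X ^ m : ℕ) : ℝ) = (Mq n X : ℝ) ^ m := by push_cast; ring
      _ ≤ scale n 0 X ^ m := pow_le_pow_left₀ (Nat.cast_nonneg _) (M_le hX1.le) _
      _ = scale (m * n) 0 X := by rw [scale_pow hX1.le]; ring_nf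
  have hΨ : scale (m * n) 0 X * Real.log X = Psq m n X := by
    rw [Psq, ← scale_zero_one, scale_mul_scale hX1]; ring_nf
  calc b ^ (Mq n X ^ m - 1) ≤ b ^ (Mq n X ^ m) := pow_le_pow_right₀ hb1 (Nat.sub_le _ _)
    _ = Real.exp ((Mq n X ^ m : ℕ) * Real.log b) := by
        rw [← Real.exp_log (pow_pos (by linarith) _), Real.log_pow]
    _ ≤ Real.exp ((n + 4) * Psq m n X) := by
        refine Real.exp_le_exp.mpr ?_
        calc ((Mq n X ^ m : ℕ) : ℝ) * Real.log b ≤ scale (m * n) 0 X * ((n + 4) * Real.log X) :=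
              mul_le_mul hMm hlogb (Real.log_nonneg hb1) (scale_nonneg hX1.le)
          _ = (n + 4) * Psq m n X := by rw [← hΨ]; ring

/-- Elementary facts on `r = M₁(V+1)` and `R = 8rX^{mn-m-n}` (`X ≥ 1`, `M₁ ≥ 1`): `0 < r < R`,
`0 ≤ 2r/(R-r) ≤ X^{-(mn-m-n)}`, and `(2r/(R-r))(R+r) ≤ 6r`. [folklore] -/
theorem r_R_facts {V X : ℝ} (hV : 0 ≤ V) (hX : 1 ≤ X) (hM1 : (1 : ℝ) ≤ M1q m n X) :
    let r := (M1q m n X : ℝ) * (V + 1)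
    0 < r ∧ r < Rbq m n V X ∧ 0 ≤ 2 * r / (Rbq m n V X - r) ∧
      2 * r / (Rbq m n V X - r) ≤ (X ^ (m * n - (m + n)))⁻¹ ∧
      2 * r / (Rbq m n V X - r) * (Rbq m n V X + r) ≤ 6 * r := by
  intro r
  have hr : 0 < r := by positivity
  have hXk : (1 : ℝ) ≤ X ^ (m * n - (m + n)) := one_le_pow₀ hX
  have hR : Rbq m n V X = 8 * r * X ^ (m * n - (m + n)) := rfl
  have hRr : 4 * r * X ^ (m * n - (m + n)) ≤ Rbq m n V X - r := by rw [hR]; nlinarith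
  have hRr0 : 0 < Rbq m n V X - r := by nlinarith
  refine ⟨hr, by linarith, by positivity, ?_, ?_⟩
  · rw [div_le_iff₀ hRr0, ← div_eq_inv_mul]
    rw [le_div_iff₀ (by positivity)]
    nlinarith
  · rw [div_mul_eq_mul_div, div_le_iff₀ hRr0]
    nlinarith

/-- **`(2r/(R-r))^{M^m} ≤ exp(-(mn-m-n)2^{-m} Ψ)` eventually** (`n ≥ 1`). [folklore] -/
theorem eventually_qpow_le (hn : 1 ≤ n) {V : ℝ} (hV : 0 ≤ V) :
    ∀ᶠ X in atTop, (2 * ((M1q m n X : ℝ) * (V + 1)) / (Rbq m n V X - (M1q m n X : ℝ) * (V + 1))) ^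
        (Mq n X ^ m) ≤ Real.exp (-(((m * n - (m + n) : ℕ) : ℝ) / 2 ^ m * Psq m n X)) := by
  filter_upwards [eventually_M_ge (n := n) hn, eventually_gt_atTop (1 : ℝ)] with X hM hX1
  have hM1ge1 : (1 : ℝ) ≤ M1q m n X := by
    exact_mod_cast one_le_M1 (m := m) (n := n) (X := X) (by have := hM.2; omega)
  obtain ⟨hr, -, hq0, hq, -⟩ := r_R_facts (m := m) (n := n) hV hX1.le hM1ge1
  set q : ℝ := 2 * ((M1q m n X : ℝ) * (V + 1)) / (Rbq m n V X - (M1q m n X : ℝ) * (V + 1)) with hqdef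
  have hXpos : 0 < X := by linarith
  have hXk : 0 < X ^ (m * n - (m + n)) := pow_pos hXpos _
  calc q ^ (Mq n X ^ m) ≤ ((X ^ (m * n - (m + n)))⁻¹) ^ (Mq n X ^ m) := pow_le_pow_left₀ hq0 hq _
    _ = Real.exp (-(((Mq n X ^ m : ℕ) : ℝ) * (((m * n - (m + n) : ℕ) : ℝ) * Real.log X))) := by
        rw [← Real.exp_log (pow_pos (inv_pos.mpr hXk) _), Real.log_pow, Real.log_inv, Real.log_pow]
        ring_nf
    _ ≤ Real.exp (-(((m * n - (m + n) : ℕ) : ℝ) / 2 ^ m * Psq m n X)) := by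
        refine Real.exp_le_exp.mpr (neg_le_neg ?_)
        have hMm : scale (m * n) 0 X / 2 ^ m ≤ ((Mq n X ^ m : ℕ) : ℝ) := by
          calc scale (m * n) 0 X / 2 ^ m = (scale n 0 X / 2) ^ m := by
                rw [div_pow, scale_pow hX1.le]; ring_nf
            _ ≤ (Mq n X : ℝ) ^ m := pow_le_pow_left₀ (by have := scale_nonneg (a := n) (b := 0) hX1.le; positivity) hM.1 _
            _ = ((Mq n X ^ m : ℕ) : ℝ) := by push_cast; ring
        have hΨ : scale (m * n) 0 X * Real.log X = Psq m n X := by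
          rw [Psq, ← scale_zero_one, scale_mul_scale hX1]; ring_nf
        have hk0 : (0 : ℝ) ≤ ((m * n - (m + n) : ℕ) : ℝ) * Real.log X := by
          have := Real.log_nonneg hX1.le; positivity
        calc ((m * n - (m + n) : ℕ) : ℝ) / 2 ^ m * Psq m n X
            = (scale (m * n) 0 X / 2 ^ m) * (((m * n - (m + n) : ℕ) : ℝ) * Real.log X) := by
              rw [← hΨ]; ring
          _ ≤ ((Mq n X ^ m : ℕ) : ℝ) * (((m * n - (m + n) : ℕ) : ℝ) * Real.log X) :=
              mul_le_mul_of_nonneg_right hMm hk0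

/-- **The eventual domination used for every constraint**: for `mn > m + n`, any constants
`K₁, K₂, K₃` and `c > 0`, `K₁Φ + K₂X^{mn} + K₃ ≤ cΨ` for all large `X` (the `X`-power `m+n < mn`
and the `log`-power `0 < 1` decide). [folklore] -/
theorem eventually_dominated (hmn : m + n < m * n) (K₁ K₂ K₃ : ℝ) {c : ℝ} (hc : 0 < c) :
    ∀ᶠ X in atTop, K₁ * Phq m n X + K₂ * scale (m * n) 0 X + K₃ ≤ c * Psq m n X := by
  have hlt1 : ((m + n : ℕ) : ℝ) < (m : ℝ) * n := by exact_mod_cast hmn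
  have hmn0 : (0 : ℝ) < (m : ℝ) * n := lt_of_le_of_lt (by positivity) hlt1
  have h1 := eventually_mul_scale_le_of_lt hlt1 0 1 (3 * K₁ / c)
  have h2 := eventually_mul_scale_le_of_lt_right ((m : ℝ) * n) zero_lt_one (3 * K₂ / c)
  have h3 := eventually_const_le_scale (a := (m : ℝ) * n) (b := 1) (Or.inl hmn0) (3 * K₃ / c)
  filter_upwards [h1, h2, h3] with X hX1 hX2 hX3
  have e1 : scale ((m + n : ℕ) : ℝ) 0 X = Phq m n X := by rw [Phq]; push_cast; rfl
  have e3 : scale ((m : ℝ) * n) 1 X = Psq m n X := rfl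
  rw [e1, e3] at hX1
  rw [e3] at hX2 hX3
  have hc3 : c / 3 > 0 := by positivity
  have i1 : K₁ * Phq m n X ≤ c / 3 * Psq m n X := by
    have := mul_le_mul_of_nonneg_left hX1 hc3.le
    calc K₁ * Phq m n X = c / 3 * (3 * K₁ / c * Phq m n X) := by field_simp
      _ ≤ c / 3 * Psq m n X := this
  have i2 : K₂ * scale (m * n) 0 X ≤ c / 3 * Psq m n X := by
    have := mul_le_mul_of_nonneg_left hX2 hc3.le
    calc K₂ * scale (m * n) 0 X = c / 3 * (3 * K₂ / c * scale ((m : ℝ) * n) 0 X) := by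
          field_simp
      _ ≤ c / 3 * Psq m n X := this
  have i3 : K₃ ≤ c / 3 * Psq m n X := by
    have := mul_le_mul_of_nonneg_left hX3 hc3.le
    calc K₃ = c / 3 * (3 * K₃ / c) := by field_simp
      _ ≤ c / 3 * Psq m n X := this
  linarith

/-! ### The smallness `|Q_{μj}(θ)| ≤ exp(-c_S X^{mn} log X)` -/

/-- `c_S = (mn - m - n)/2^{m+2}`, the constant of the smallness exponent `S = c_S X^{mn} log X`.
[cite: Diaz1989, Théorème 2 p. 2 (our parameters; cf. §II-4-2 p. 15, c₁₉)] -/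
def cSq (m n : ℕ) : ℝ := ((m * n - (m + n) : ℕ) : ℝ) / 2 ^ (m + 2)

/-- `0 ≤ c_S ≤ n`. [folklore] -/
theorem cSq_nonneg_le : 0 ≤ cSq m n ∧ cSq m n ≤ n := by
  refine ⟨by unfold cSq; positivity, ?_⟩
  unfold cSq
  rw [div_le_iff₀ (by positivity)]
  have h1 : ((m * n - (m + n) : ℕ) : ℝ) ≤ m * n := by exact_mod_cast Nat.sub_le _ _
  have h2 : (m : ℝ) ≤ 2 ^ m := by exact_mod_cast (Nat.lt_two_pow_self).le
  have hn : (0 : ℝ) ≤ n := Nat.cast_nonneg n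
  calc ((m * n - (m + n) : ℕ) : ℝ) ≤ m * n := h1
    _ ≤ 2 ^ m * n := by nlinarith
    _ ≤ n * 2 ^ (m + 2) := by rw [pow_add]; nlinarith [pow_nonneg (show (0:ℝ) ≤ 2 by norm_num) m]

/-- `c_S > 0` for `mn > m + n`. [folklore] -/
theorem cSq_pos (hmn : m + n < m * n) : 0 < cSq m n := by
  unfold cSq
  have : 1 ≤ m * n - (m + n) := by omega
  have : (1 : ℝ) ≤ ((m * n - (m + n) : ℕ) : ℝ) := by exact_mod_cast this
  positivity

set_option maxHeartbeats 1000000 in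
/-- **The smallness, pointwise form**: at a fixed `X > 1`, the closed-form estimate
`DiazThm1.norm_aeval_Qj_le` (with `D = 1`) together with the bounds of this file for `T_A, ε₁, B_R, Λ,
(2r)^{S-1}, (6r)^{S-1}, (2r/(R-r))^S, M^m` and the three dominations gives `|Q_{μj}(θ)| ≤ exp(-c_S Ψ)`.
[cite: Diaz1989, §II-3-2 (7) p. 11 and §II-4-2 (c) p. 15] -/
theorem small_of_bounds {m' : ℕ} (u : Fin n → ℂ)
    (v : Fin (m' + 1) → ℂ) {X A : ℝ} (hX1 : 1 < X) (hA1 : 1 ≤ A)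
    (hθA : ∀ i, ‖theta u v i‖ + 1 ≤ A) (hM2 : 2 ≤ Mq n X) (hH1 : 1 ≤ Hq (m' + 1) n X)
    {δ : ℝ} (hδ0 : 0 < δ) (hδ1 : δ ≤ 1) (hsep : Separated v (Mq n X) δ)
    (hTA : TAb (m' + 1) n 1 (Lq (m' + 1) n X) (Mq n X) (Hq (m' + 1) n X) A
        (Real.exp (-rhoq (m' + 1) n X)) (M1q (m' + 1) n X) (Usum u) (Vsum v) ≤
      Real.exp (KAq (m' + 1) n A (Usum u) (Vsum v) * Phq (m' + 1) n X - rhoq (m' + 1) n X))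
    (hε1 : eps1 (m' + 1) n 1 (Lq (m' + 1) n X) (Mq n X) (Hq (m' + 1) n X) A
        (Real.exp (-rhoq (m' + 1) n X)) ≤ Real.exp (Kepsq (m' + 1) n A * Phq (m' + 1) n X - rhoq (m' + 1) n X))
    (hBgr : Bgr (m' + 1) n 1 (Lq (m' + 1) n X) (Mq n X) (Hq (m' + 1) n X) A (Usum u)
        (Rbq (m' + 1) n (Vsum v) X) ≤ Real.exp (KBq (m' + 1) n A * Phq (m' + 1) n X +
          KR (m' + 1) n (Usum u) (Vsum v) * scale ((m' + 1 : ℕ) * n) 0 X))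
    (hΛ : Real.exp (-((n + 2) * Psq (m' + 1) n X)) ≤ LamLB m' (Mq n X) δ v)
    (hr2 : (2 * ((M1q (m' + 1) n X : ℝ) * (Vsum v + 1))) ^ (Mq n X ^ (m' + 1) - 1) ≤
      Real.exp ((n + 4) * Psq (m' + 1) n X))
    (hr6 : (6 * ((M1q (m' + 1) n X : ℝ) * (Vsum v + 1))) ^ (Mq n X ^ (m' + 1) - 1) ≤
      Real.exp ((n + 4) * Psq (m' + 1) n X))
    (hq : (2 * ((M1q (m' + 1) n X : ℝ) * (Vsum v + 1)) /
        (Rbq (m' + 1) n (Vsum v) X - (M1q (m' + 1) n X : ℝ) * (Vsum v + 1))) ^ (Mq n X ^ (m' + 1)) ≤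
      Real.exp (-((((m' + 1) * n - ((m' + 1) + n) : ℕ) : ℝ) / 2 ^ (m' + 1) * Psq (m' + 1) n X)))
    (hSexp : (Mq n X : ℝ) ^ (m' + 1) ≤ Real.exp (Phq (m' + 1) n X))
    (hdA : KAq (m' + 1) n A (Usum u) (Vsum v) * Phq (m' + 1) n X + Real.log 4 ≤
      (16 * (n + 1) - cSq (m' + 1) n) * Psq (m' + 1) n X)
    (hd1 : (1 + Kepsq (m' + 1) n A) * Phq (m' + 1) n X + Real.log 4 ≤
      (16 * (n + 1) - (2 * n + 6) - cSq (m' + 1) n) * Psq (m' + 1) n X)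
    (hd2 : KBq (m' + 1) n A * Phq (m' + 1) n X + KR (m' + 1) n (Usum u) (Vsum v) *
        scale ((m' + 1 : ℕ) * n) 0 X + Real.log 4 ≤
      3 * cSq (m' + 1) n * Psq (m' + 1) n X)
    (p : Unk (m' + 1) n 1 (Lq (m' + 1) n X) (Mq n X) → ℤ)
    (hp : ∀ w, |(p w : ℝ)| ≤ Hq (m' + 1) n X)
    (hvan : ∀ μ' : Fin (m' + 1) → ℕ, (∀ k, μ' k < Mq n X) → Q p μ' = 0)
    (θ' : Var (m' + 1) n → ℂ) (hθ' : ∀ i, ‖theta u v i - θ' i‖ ≤ Real.exp (-rhoq (m' + 1) n X))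
    (j : Var (m' + 1) n →₀ ℕ) (hj : IsMinIdx p θ' j)
    (μ : Fin (m' + 1) → ℕ) (hμ : ∀ k, μ k < M1q (m' + 1) n X) :
    ‖MvPolynomial.aeval (theta u v) (Qj p μ j)‖ ≤ Real.exp (-(cSq (m' + 1) n * Psq (m' + 1) n X)) := by
  classical
  have hV : 0 ≤ Vsum v := Finset.sum_nonneg fun _ _ => norm_nonneg _
  have hM1le : Mq n X ≤ M1q (m' + 1) n X := M_le_M1 X
  have hM1r : (1 : ℝ) ≤ M1q (m' + 1) n X := by exact_mod_cast (show 1 ≤ M1q (m' + 1) n X by omega)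
  have hρ0 : 0 ≤ rhoq (m' + 1) n X := by
    unfold rhoq
    have := scale_nonneg (a := ((m' + 1 : ℕ) : ℝ) * n) (b := 1) hX1.le
    push_cast at this ⊢
    positivity
  have hε0 : 0 ≤ Real.exp (-rhoq (m' + 1) n X) := (Real.exp_pos _).le
  have hεle1 : Real.exp (-rhoq (m' + 1) n X) ≤ 1 := by rw [Real.exp_le_one_iff]; linarith
  have hθ : ∀ i, ‖theta u v i‖ ≤ A := fun i => by linarith [hθA i]
  have hθ'A : ∀ i, ‖θ' i‖ ≤ A := fun i => by
    have := norm_sub_norm_le (θ' i) (theta u v i)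
    rw [norm_sub_rev] at this
    linarith [hθ' i, hθA i]
  obtain ⟨hr0, hrR, hq0, hq1, hqRr⟩ :=
    r_R_facts (m := m' + 1) (n := n) (V := Vsum v) (X := X) hV hX1.le hM1r
  -- the closed-form estimate
  have key := norm_aeval_Qj_le u v (p := p) (by linarith) hp hA1 hε0 hθ hθ'A hθ' hM2 hM1le hvan
    hsep hδ0 hδ1 (R := Rbq (m' + 1) n (Vsum v) X) hrR hj hμ
  refine key.trans ?_
  have hrad : rad (M1q (m' + 1) n X) v = (M1q (m' + 1) n X : ℝ) * (Vsum v + 1) := rfl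
  rw [hrad]
  have hkc : (((m' + 1) * n - ((m' + 1) + n) : ℕ) : ℝ) / 2 ^ (m' + 1) - cSq (m' + 1) n =
      3 * cSq (m' + 1) n := by
    unfold cSq; rw [pow_add]; ring
  have hΛpos : 0 < LamLB m' (Mq n X) δ v := lt_of_lt_of_le (Real.exp_pos _) hΛ
  have hinvΛ : (LamLB m' (Mq n X) δ v)⁻¹ ≤ Real.exp ((n + 2) * Psq (m' + 1) n X) := by
    rw [inv_le_comm₀ hΛpos (Real.exp_pos _), ← Real.exp_neg]; exact hΛ
  have hS : (((Mq n X ^ (m' + 1) : ℕ)) : ℝ) ≤ Real.exp (Phq (m' + 1) n X) := by push_cast; exact hSexp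
  have hS1 : 1 ≤ Mq n X ^ (m' + 1) := Nat.one_le_pow _ _ (by omega)
  have he10 : 0 ≤ eps1 (m' + 1) n 1 (Lq (m' + 1) n X) (Mq n X) (Hq (m' + 1) n X) A
      (Real.exp (-rhoq (m' + 1) n X)) := by
    unfold eps1
    exact mul_nonneg (mul_nonneg (Nat.cast_nonneg _) (Pmax_nonneg (by linarith) (by linarith)))
      (by positivity)
  have hB0 : 0 ≤ Bgr (m' + 1) n 1 (Lq (m' + 1) n X) (Mq n X) (Hq (m' + 1) n X) A
      (Usum u) (Rbq (m' + 1) n (Vsum v) X) := by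
    unfold Bgr
    exact mul_nonneg (mul_nonneg (Nat.cast_nonneg _) (Pmax_nonneg (by linarith) (by linarith)))
      (by positivity)
  have hq1' : 2 * ((M1q (m' + 1) n X : ℝ) * (Vsum v + 1)) /
      (Rbq (m' + 1) n (Vsum v) X - (M1q (m' + 1) n X : ℝ) * (Vsum v + 1)) ≤ 1 :=
    hq1.trans (inv_le_one_of_one_le₀ (one_le_pow₀ hX1.le))
  have hρ : rhoq (m' + 1) n X = 16 * (n + 1) * Psq (m' + 1) n X := by
    unfold rhoq Psq; push_cast; ring_nf
  -- generic names for readability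
  generalize hSdef : (Mq n X ^ (m' + 1) : ℕ) = S at *
  generalize hrdef : (M1q (m' + 1) n X : ℝ) * (Vsum v + 1) = r at *
  generalize hRdef : Rbq (m' + 1) n (Vsum v) X = Rr at *
  generalize hΛdef : LamLB m' (Mq n X) δ v = Λ at *
  generalize he1 : eps1 (m' + 1) n 1 (Lq (m' + 1) n X) (Mq n X) (Hq (m' + 1) n X) A
      (Real.exp (-rhoq (m' + 1) n X)) = e1 at *
  generalize hBdef : Bgr (m' + 1) n 1 (Lq (m' + 1) n X) (Mq n X) (Hq (m' + 1) n X) A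
      (Usum u) Rr = B at *
  generalize hTAdef : TAb (m' + 1) n 1 (Lq (m' + 1) n X) (Mq n X) (Hq (m' + 1) n X) A
      (Real.exp (-rhoq (m' + 1) n X)) (M1q (m' + 1) n X) (Usum u) (Vsum v) = TA at *
  set q : ℝ := 2 * r / (Rr - r) with hqdef
  set Ψ := Psq (m' + 1) n X with hΨdef
  set Φ := Phq (m' + 1) n X with hΦdef
  set Tgt : ℝ := Real.exp (-(cSq (m' + 1) n * Ψ) - Real.log 4) with hTgt
  have hTgt4 : 4 * Tgt = Real.exp (-(cSq (m' + 1) n * Ψ)) := by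
    rw [hTgt, Real.exp_sub, Real.exp_log (by norm_num)]; ring
  -- (i)
  have b1 : TA ≤ Tgt := by
    refine hTA.trans (Real.exp_le_exp.mpr ?_)
    rw [hρ]; linarith
  -- (ii)
  have b2 : (S : ℝ) * e1 * (2 * r) ^ (S - 1) / Λ ≤ Tgt := by
    rw [div_eq_mul_inv]
    calc (S : ℝ) * e1 * (2 * r) ^ (S - 1) * Λ⁻¹
        ≤ Real.exp Φ * Real.exp (Kepsq (m' + 1) n A * Φ - rhoq (m' + 1) n X) *
          Real.exp ((n + 4) * Ψ) * Real.exp ((n + 2) * Ψ) := by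
          refine mul_le_mul (mul_le_mul (mul_le_mul hS hε1 he10 (by positivity)) hr2 (by positivity)
            (by positivity)) hinvΛ (by positivity) (by positivity)
      _ ≤ Tgt := by
          simp only [← Real.exp_add, hTgt]
          refine Real.exp_le_exp.mpr ?_
          rw [hρ]; linarith
  -- (iii)
  have b3 : q ^ S * B ≤ Tgt := by
    calc q ^ S * B ≤ Real.exp (-((((m' + 1) * n - ((m' + 1) + n) : ℕ) : ℝ) / 2 ^ (m' + 1) * Ψ)) *
          Real.exp (KBq (m' + 1) n A * Φ + KR (m' + 1) n (Usum u) (Vsum v) *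
            scale ((m' + 1 : ℕ) * n) 0 X) :=
          mul_le_mul hq hBgr hB0 (by positivity)
      _ ≤ Tgt := by
          simp only [← Real.exp_add, hTgt]
          refine Real.exp_le_exp.mpr ?_
          nlinarith [hd2, hkc]
  -- (iv)
  have b4 : q ^ S * ((S : ℝ) * e1 * (Rr + r) ^ (S - 1) / Λ) ≤ Tgt := by
    have hRr0 : 0 ≤ Rr + r := by linarith
    have hgeom0 : 0 ≤ q ^ S * (Rr + r) ^ (S - 1) := mul_nonneg (pow_nonneg hq0 _) (pow_nonneg hRr0 _)
    have hgeom : q ^ S * (Rr + r) ^ (S - 1) ≤ (6 * r) ^ (S - 1) := by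
      calc q ^ S * (Rr + r) ^ (S - 1) = q * (q * (Rr + r)) ^ (S - 1) := by
            rw [mul_pow, ← mul_assoc, ← pow_succ']
            congr 2; omega
        _ ≤ 1 * (6 * r) ^ (S - 1) :=
            mul_le_mul hq1' (pow_le_pow_left₀ (mul_nonneg hq0 hRr0) hqRr _) (by positivity) zero_le_one
        _ = (6 * r) ^ (S - 1) := one_mul _
    calc q ^ S * ((S : ℝ) * e1 * (Rr + r) ^ (S - 1) / Λ)
        = (S : ℝ) * e1 * (q ^ S * (Rr + r) ^ (S - 1)) * Λ⁻¹ := by rw [div_eq_mul_inv]; ring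
      _ ≤ Real.exp Φ * Real.exp (Kepsq (m' + 1) n A * Φ - rhoq (m' + 1) n X) *
          Real.exp ((n + 4) * Ψ) * Real.exp ((n + 2) * Ψ) := by
          refine mul_le_mul (mul_le_mul (mul_le_mul hS hε1 he10 (by positivity)) (hgeom.trans hr6)
            hgeom0 (by positivity)) hinvΛ (by positivity) (by positivity)
      _ ≤ Tgt := by
          simp only [← Real.exp_add, hTgt]
          refine Real.exp_le_exp.mpr ?_
          rw [hρ]; linarith
  -- sum up
  rw [← hTgt4]
  have hdist : q ^ S * (B + (S : ℝ) * e1 * (Rr + r) ^ (S - 1) / Λ) =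
      q ^ S * B + q ^ S * ((S : ℝ) * e1 * (Rr + r) ^ (S - 1) / Λ) := by ring
  rw [hdist]
  linarith [b1, b2, b3, b4]

/-- **The smallness for the chosen parameters** (the analogue for Théorème 2 of Diaz's (7) and
§II-4-2 (c): `|Q_{μj}(θ)| ≤ exp(-c X^{mn} log X)`). For `m = m'+1 ≥ 2`, `n ≥ 1`, `mn > m + n`,
`v` with measure (b) (any exponent), and all large `X`: if the unknowns `p` of Siegel's step are
bounded by `H`, the `Q_{μ'}` vanish for `|μ'| < M`, `θ̃` lies in the ball `𝓑_ρ` and `j` is a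
minimal index at `θ̃`, then `|Q_{μj}(θ)| ≤ exp(-c_S X^{mn} log X)` for every `|μ| < M₁`.
[cite: Diaz1989, §II-3-2 (7) p. 11 and §II-4-2 (c) p. 15] -/
theorem eventually_small {m' : ℕ} (hm' : 1 ≤ m') (hn : 1 ≤ n)
    (hmn : (m' + 1) + n < (m' + 1) * n) (u : Fin n → ℂ)
    (v : Fin (m' + 1) → ℂ) {η : ℝ} (hBv : Diaz1989.MeasureB v η) :
    ∀ᶠ X in atTop, ∀ (p : Unk (m' + 1) n 1 (Lq (m' + 1) n X) (Mq n X) → ℤ),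
      (∀ w, |(p w : ℝ)| ≤ Hq (m' + 1) n X) →
      (∀ μ' : Fin (m' + 1) → ℕ, (∀ k, μ' k < Mq n X) → Q p μ' = 0) →
      ∀ θ' : Var (m' + 1) n → ℂ, (∀ i, ‖theta u v i - θ' i‖ ≤ Real.exp (-rhoq (m' + 1) n X)) →
      ∀ j : Var (m' + 1) n →₀ ℕ, IsMinIdx p θ' j →
      ∀ μ : Fin (m' + 1) → ℕ, (∀ k, μ k < M1q (m' + 1) n X) →
        ‖MvPolynomial.aeval (theta u v) (Qj p μ j)‖ ≤ Real.exp (-(cSq (m' + 1) n * Psq (m' + 1) n X)) := by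
  classical
  have hm : 1 ≤ m' + 1 := by omega
  -- data-dependent constants
  set A : ℝ := 2 + ∑ i, ‖theta u v i‖ with hAdef
  have hsum : 0 ≤ ∑ i, ‖theta u v i‖ := Finset.sum_nonneg fun i _ => norm_nonneg (theta u v i)
  have hA1 : 1 ≤ A := by rw [hAdef]; linarith
  have hθA : ∀ i, ‖theta u v i‖ + 1 ≤ A := fun i => by
    rw [hAdef]
    have := Finset.single_le_sum (fun i (_ : i ∈ Finset.univ) => norm_nonneg (theta u v i))
      (Finset.mem_univ i)
    linarith
  have hU : 0 ≤ Usum u := Finset.sum_nonneg fun _ _ => norm_nonneg _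
  have hV : 0 ≤ Vsum v := Finset.sum_nonneg fun _ _ => norm_nonneg _
  set ω : ℝ := min 1 (‖v (Fin.last m')‖ / 2) with hωdef
  have hω0 : 0 < ω := lt_min one_pos (by have := norm_last_pos_of_measureB hBv; linarith)
  have hω1 : ω ≤ 1 := min_le_left _ _
  obtain ⟨Xb, hXb0, hsepb⟩ := separated_of_measureB hBv
  have hcS := cSq_nonneg_le (m := m' + 1) (n := n)
  have hcSpos := cSq_pos hmn
  filter_upwards [eventually_TAb_le (n := n) hm hn hA1 hU hV, eventually_eps1_le (n := n) hm hn hA1,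
    eventually_Bgr_le (n := n) hm hn hmn.le hA1 hU hV, eventually_Lam_ge (n := n) (m' := m') hn hω0 hω1,
    eventually_rpow_le (m := m' + 1) (n := n) hn hV (c := 2) (by norm_num) (by norm_num),
    eventually_rpow_le (m := m' + 1) (n := n) hn hV (c := 6) (by norm_num) (by norm_num),
    eventually_qpow_le (m := m' + 1) (n := n) hn hV, eventually_cards_le (m := m' + 1) (n := n) (by omega),
    eventually_M_ge (n := n) hn, eventually_Hq_le (n := n) hm hn,
    eventually_const_le_scale (a := n) (b := 0) (Or.inl (by exact_mod_cast hn)) (2 * Xb + 2),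
    eventually_dominated hmn (KAq (m' + 1) n A (Usum u) (Vsum v)) 0 (Real.log 4)
      (c := 16 * (n + 1) - cSq (m' + 1) n) (by linarith [hcS.2]),
    eventually_dominated hmn (1 + Kepsq (m' + 1) n A) 0 (Real.log 4)
      (c := 16 * (n + 1) - (2 * n + 6) - cSq (m' + 1) n) (by
        have : (0 : ℝ) ≤ n := Nat.cast_nonneg n; linarith [hcS.2]),
    eventually_dominated hmn (KBq (m' + 1) n A) (KR (m' + 1) n (Usum u) (Vsum v)) (Real.log 4)
      (c := 3 * cSq (m' + 1) n) (by linarith),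
    eventually_gt_atTop (1 : ℝ)]
    with X hTA hε1 hBgr hΛ hr2 hr6 hq hcards hM hH hXb hdA hd1 hd2 hX1
    p hp hvan θ' hθ' j hj μ hμ
  obtain ⟨-, -, -, hSexp⟩ := hcards
  -- separation at `M`
  have hMXb : (Xb : ℝ) < Mq n X := by have := hM.1; linarith
  set δ : ℝ := Real.exp (-((Mq n X : ℝ) * Real.log (Mq n X))) with hδdef
  have hδ0 : 0 < δ := Real.exp_pos _
  have hδ1 : δ ≤ 1 := by
    rw [hδdef, Real.exp_le_one_iff, neg_nonpos]
    have : (1 : ℝ) ≤ Mq n X := by exact_mod_cast (show 1 ≤ Mq n X by have := hM.2; omega)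
    exact mul_nonneg (by linarith) (Real.log_nonneg this)
  have hsep : Separated v (Mq n X) δ :=
    (hsepb (Mq n X) hMXb).mono (Real.exp_le_exp.mpr (neg_le_neg (min_le_left _ _)))
  simp only [zero_mul, add_zero] at hdA hd1
  exact small_of_bounds u v hX1 hA1 hθA hM.2 hH.1 hδ0 hδ1 hsep hTA hε1 (by
    have := hBgr; push_cast at this ⊢; exact this) hΛ hr2 hr6 hq hSexp hdA hd1 (by
    have := hd2; push_cast at this ⊢; exact this) p hp hvan θ' hθ' j hj μ hμ

/-! ### Degrees and lengths of the `Q_{μj}` (the functions `δ = σ` of the criterion) -/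

/-- `c_δ = nm a₁ (1 + log 2) + (1 + nm a₁a₂) + 2n + 8`: `deg Q_{μj}, log L(Q_{μj}) ≤ c_δ Φ`.
[cite: Diaz1989, §II-4-2 (b) p. 15 (c₁₇, c₁₈)] -/
def cdq (m n : ℕ) : ℝ :=
  (n * m * a1 m n) * (1 + Real.log 2) + (1 + n * m * (a1 m n * a2 m n)) + 2 * n + 8

/-- `c_δ ≥ 1`. [folklore] -/
theorem one_le_cdq : 1 ≤ cdq m n := by
  unfold cdq
  have h2 : 0 ≤ Real.log 2 := Real.log_nonneg (by norm_num)
  have : (0 : ℝ) ≤ (n * m * a1 m n) * (1 + Real.log 2) := by positivity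
  have : (0 : ℝ) ≤ n * m * (a1 m n * a2 m n) := by positivity
  have : (0 : ℝ) ≤ n := Nat.cast_nonneg n
  linarith

/-- **Degrees and lengths for the chosen parameters**: eventually, for unknowns bounded by `H` and
`|μ| < M₁`, `deg Q_{μj} ≤ c_δ Φ` and `log L(Q_{μj}) ≤ c_δ Φ` (`m, n ≥ 1`).
[cite: Diaz1989, §II-4-2 (b) p. 15] -/
theorem eventually_deg_len (hm : 1 ≤ m) (hn : 1 ≤ n) :
    ∀ᶠ X in atTop, ∀ (p : Unk m n 1 (Lq m n X) (Mq n X) → ℤ),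
      (∀ w, |(p w : ℝ)| ≤ Hq m n X) → ∀ μ : Fin m → ℕ, (∀ k, μ k < M1q m n X) →
      ∀ j : Var m n →₀ ℕ,
        ((Qj p μ j).totalDegree : ℝ) ≤ cdq m n * Phq m n X ∧
        Real.log (l1 (Qj p μ j)) ≤ cdq m n * Phq m n X := by
  filter_upwards [eventually_cards_le (m := m) (n := n) (by omega), eventually_Hq_le (n := n) hm hn,
    eventually_M_ge (n := n) hn, eventually_ge_atTop (max (m : ℝ) (a2 m n)),
    eventually_gt_atTop (1 : ℝ)] with X hcards hH hM hXmax hX1 p hp μ hμ j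
  obtain ⟨hDL, hE, -, -⟩ := hcards
  have hXm : (m : ℝ) ≤ X := le_trans (le_max_left _ _) hXmax
  have hXa2 : (a2 m n : ℝ) ≤ X := le_trans (le_max_right _ _) hXmax
  have hΦ := Phq_nonneg (m := m) (n := n) hX1.le
  have hT0 := T0_le (m := m) (n := n) hX1
  have hT1 := T1_le (m := m) (n := n) (by omega) hX1
  have h2 : 0 ≤ Real.log 2 := Real.log_nonneg (by norm_num)
  have hn0 : (0 : ℝ) ≤ n := Nat.cast_nonneg n
  have hnm : (0 : ℝ) ≤ n * m * (a1 m n * a2 m n) := by positivity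
  have hma : (0 : ℝ) ≤ n * m * a1 m n := by positivity
  constructor
  · have := totalDegree_Qj_le p hμ j (M' := M1q m n X)
    have h' : ((Qj p μ j).totalDegree : ℝ) ≤ T0 m n 1 (Lq m n X) (Mq n X) +
        T1 m n 1 (Lq m n X) (M1q m n X) := by exact_mod_cast this
    calc ((Qj p μ j).totalDegree : ℝ) ≤ (n * m * a1 m n) * Phq m n X +
          (1 + n * m * (a1 m n * a2 m n)) * Phq m n X := by linarith
      _ ≤ cdq m n * Phq m n X := by unfold cdq; nlinarith
  · have hl1 := l1_Qj_le (n := n) (D := 1) hm p hp hμ j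
    have hM2 : (2 : ℝ) ≤ Mq n X := by exact_mod_cast hM.2
    have hm1 : (1 : ℝ) ≤ m := by exact_mod_cast hm
    have hM1r : (1 : ℝ) ≤ M1q m n X := by
      exact_mod_cast one_le_M1 (m := m) (n := n) (X := X) (by have := hM.2; omega)
    have hmM1 : (1 : ℝ) ≤ (m : ℝ) * M1q m n X := by nlinarith
    -- `(mM₁)^1 ≤ exp((n+3)Φ)`
    have hlogmM1 : Real.log ((m : ℝ) * M1q m n X) ≤ (n + 2) * Real.log X := by
      have ha2pos : (0 : ℝ) < a2 m n := by exact_mod_cast (one_le_a2 (m := m) (n := n))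
      have hmpos : (0 : ℝ) < m := by linarith
      have hMpos : (0 : ℝ) < Mq n X := by linarith
      rw [M1_eq, Real.log_mul hmpos.ne' (mul_pos ha2pos hMpos).ne', Real.log_mul ha2pos.ne' hMpos.ne']
      have h1 : Real.log m ≤ Real.log X := Real.log_le_log hmpos hXm
      have h2' : Real.log (a2 m n) ≤ Real.log X := Real.log_le_log ha2pos hXa2
      have h3 := log_M_le (n := n) hX1.le (by have := hM.2; omega)
      linarith
    have hpow : ((m : ℝ) * M1q m n X) ^ (1 : ℕ) ≤ Real.exp ((n + 3) * Phq m n X) := by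
      rw [pow_one, ← Real.exp_log (show (0 : ℝ) < (m : ℝ) * M1q m n X by positivity)]
      refine Real.exp_le_exp.mpr ?_
      have hlog0 : 0 ≤ Real.log X := Real.log_nonneg hX1.le
      calc Real.log ((m : ℝ) * M1q m n X) ≤ (n + 2) * Real.log X := hlogmM1
        _ ≤ (n + 3) * Real.log X := by nlinarith
        _ ≤ (n + 3) * Phq m n X :=
            mul_le_mul_of_nonneg_left (log_le_Phq (by omega) hX1.le) (by positivity)
    set T : ℝ := (T0 m n 1 (Lq m n X) (Mq n X) : ℝ) with hT
    have h2T : (2 : ℝ) ^ T0 m n 1 (Lq m n X) (Mq n X) = Real.exp (T * Real.log 2) := by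
      rw [← Real.exp_log (pow_pos two_pos _), Real.log_pow, hT]
    have hbound : l1 (Qj p μ j) ≤ Real.exp (cdq m n * Phq m n X) := by
      refine hl1.trans ?_
      rw [h2T]
      calc (Fintype.card (DL n 1 (Lq m n X)) : ℝ) *
            (Real.exp (T * Real.log 2) * ((Fintype.card (ExpIdx m n 1 (Lq m n X) (Mq n X)) : ℝ) *
              Hq m n X) * ((m : ℝ) * M1q m n X) ^ (1 : ℕ))
          ≤ Real.exp (Phq m n X) * (Real.exp (T * Real.log 2) * (Real.exp (Phq m n X) *
              Real.exp ((n + 3) * Phq m n X)) * Real.exp ((n + 3) * Phq m n X)) := by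
            have hH0 : 0 ≤ Hq m n X := by linarith [hH.1]
            refine mul_le_mul hDL (mul_le_mul (mul_le_mul_of_nonneg_left
              (mul_le_mul hE hH.2 hH0 (by positivity)) (by positivity)) hpow
              (by positivity) (by positivity)) (by positivity) (by positivity)
        _ = Real.exp (T * Real.log 2 + (2 * n + 8) * Phq m n X) := by
            simp only [← Real.exp_add]; ring_nf
        _ ≤ Real.exp (cdq m n * Phq m n X) := by
            refine Real.exp_le_exp.mpr ?_
            unfold cdq
            have := mul_le_mul_of_nonneg_right hT0 h2
            nlinarith
    by_cases h0 : l1 (Qj p μ j) = 0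
    · rw [h0, Real.log_zero]
      have := one_le_cdq (m := m) (n := n)
      positivity
    · have hpos : 0 < l1 (Qj p μ j) := lt_of_le_of_ne (wnorm_nonneg _ _) (Ne.symm h0)
      exact (Real.log_le_iff_le_exp hpos).mpr hbound

end DiazThm2

end Literature.NumberTheory.Transcendental

end
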